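import Literature.MathematicalPhysics.QuantumFieldTheory.Balaban1983to89.HaarExpChartClosedSubgroup

/-!
# `Balaban1983to89.HaarDensityEvenClosedSubgroup` — «σ(A) is an … EVEN function of A …, INVARIANT with respect to the
# adjoint representation of the group G» ([Balaban1985UV3] p. 260) for EVERY closed subgroup `G ≤ U(N)`:
# `tr ad_𝐠 X = 0` on the Lie algebra of a compact linear group, hence `det jac(−X) = det jac(X)` and
# `det jac(uXu*) = det jac(X)` for `u ∈ G`

statement-level skeleton of published theorems with citation tags; proofs where landed; nothing here is a claim
about the Yang–Mills mass gap

Mega-formalization `lit-balaban` (HOME `run/shared/lean/pub/lit-balaban/`), unit `lit-balaban-p24` gen 12, rider to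
`HaarExpChartClosedSubgroup` (p322107; free-target protocol G.5-34(d); referee ref-5).  SKELETON rows served (SUPPORT
cells, no head change): B10.Eq21 / display E18 (the adjectives «even», «invariant with respect to the adjoint
representation» of the Haar density `σ`, [Balaban1985UV3] p. 260, owner r07; r07's `B10Eq18SigmaEven` proves «even ⇔
tr ad A = 0» and discharges `tr ad = 0` for SEMISIMPLE Lie algebras and for `gl(N)`; r10's `B13HaarSigmaJacobian`
proves `det jac(−x) = det jac(x)` GIVEN `tr ad x = 0` (`det_jac_real_neg_of_trace_eq_zero`) and `Ad`-invariance
GIVEN `u𝔤u⁻¹ = 𝔤` (`det_jac_Adg`)).  This file discharges both hypotheses for every closed `G ≤ U(N)` — print's standing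
generality ([Balaban1987RG1] §0 p. 251 «G ⊂ U(N)»), which includes the non-semisimple `U(N)`, `U(1)`, tori.

CITATION HEADER.  [Balaban1985UV3] T. Bałaban, CMP **102** (1985) p. 260: *«Generally σ(A) is an analytic, positive, even
function of A in a neighbourhood of 0∈𝔤, invariant with respect to the adjoint representation of the group G.»*
[Helgason2000] Ch. I §1 Thm. 1.14 p. 96: `σ/σ₀ = det((1 − e^{−adX})/adX)` (r10's dictionary `det_jac_real_eq_sigmaRel`);
evenness of this function is equivalent to `det e^{−adX} = 1`, i.e. `tr ad X = 0` (r07), which holds on the Lie algebra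
of any COMPACT group (unimodularity); here it is proved directly: `ad X` is skew for the trace form `Re tr(A*C)`.
[Hall2015] B. C. Hall, GTM 222, Thm. 3.20 (`Ad_A(𝔤) ⊆ 𝔤`), Prop. 4.8 / §3.6 (the trace inner product on `M_N(ℂ)`).

WHAT IS PROVED (0 sorry; two plumbing definitions `trForm` (the real bilinear form `Re tr(AᴴC)`) and `toUnit`
(`u ∈ G` as a unit of `M_N(ℂ)`); no named fact; axioms standard).
* §1 `trForm`: symmetric (`trForm_comm`), `trForm A A = Σ|A_ij|²` (`trForm_self_eq_sum`), positive definite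
  (`trForm_self_eq_zero_iff`), and **`trForm_bracket_left`**: `⟨[X,A], C⟩ = −⟨A, [X,C]⟩` when `X* = −X`.
* §2 **`trace_adg_eq_zero`**: `tr(ad_𝐠 X) = 0` for every `X` in ANY `ad`-stable real subspace `𝐠 ⊆ 𝔲(N)` (Gram matrix
  `P` of a basis, `P·[ad X] = −[ad X]ᵀ·P`, `P` invertible ⇒ `tr = −tr`); **`det_jac_neg`**: `det jac(−X) = det jac(X)`.
* §3 for every closed `G ≤ U(N)` (gen 8's chart): `trace_adg_chart_eq_zero`, **`jdet_neg`** («even»),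
  `conj_mem_lie`/`conj_mem_lie'` (`u𝐠u* = 𝐠`), **`jdet_Ad`** («Ad-invariant»: `jdet(uXu*) = jdet(X)`), `coe_Adg`.

HONEST SCOPE.  (i) «analytic» and «positive near 0» are r10's `B13HaarSigmaJacobian` / file `HaarExpChartLocal`
(`exists_ball_jdet_near_one`), not repeated.  (ii) Evenness is proved for the FUNCTION `X ↦ det jac(X)` on all of `𝐠`
(print: «in a neighbourhood of 0»).  (iii) Nothing printed is contradicted; no SKELETON head changes.
-/

noncomputable section

open NormedSpace Metric Set MeasureTheory
open scoped ENNReal NNReal Matrix ComplexConjugate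

namespace Literature.MathematicalPhysics.QuantumFieldTheory.Balaban1983to89.HaarDensityEvenClosedSubgroup

open B13HaarSigmaJacobian (adg adg_apply_coe jac Adg Adg_apply_coe det_jac_Adg det_jac_real_neg_of_trace_eq_zero)
open HaarExpChartLocal (jdet jdet_eq_det)
open HaarExpChartClosedSubgroup (chart hlie)
open LogChartClosedSubgroup (unitarySubgroupLogChart star_eq_neg_of_mem_unitarySubgroupLogChart_lie
  star_mem_unitarySubgroupLogChart_carrier)

open scoped Matrix.Norms.L2Operator

variable {n : Type*} [Fintype n] [DecidableEq n]

/-! ## §1  The real trace form `⟨A, C⟩ = Re tr(Aᴴ C)` on `M_N(ℂ)`: positive definite, and `ad X` is skew for it when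
`Xᴴ = −X` -/

section TrForm

/-- The real Frobenius (Hilbert–Schmidt) form `⟨A, C⟩ = Re tr(Aᴴ C)` on `M_N(ℂ)`, as a real bilinear form.
[cite: Hall2015, Prop. 4.8 / §3.6] -/
def trForm : LinearMap.BilinForm ℝ (Matrix n n ℂ) :=
  LinearMap.mk₂ ℝ (fun A C : Matrix n n ℂ => ((Aᴴ * C).trace).re)
    (fun A A' C => by simp only [Matrix.conjTranspose_add, add_mul, Matrix.trace_add, Complex.add_re])
    (fun c A C => by
      simp only [Matrix.conjTranspose_smul, star_trivial, Matrix.smul_mul, Matrix.trace_smul, Complex.smul_re,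
        smul_eq_mul])
    (fun A C C' => by simp only [mul_add, Matrix.trace_add, Complex.add_re])
    (fun c A C => by simp only [Matrix.mul_smul, Matrix.trace_smul, Complex.smul_re, smul_eq_mul])

/-- [cite: Hall2015, §3.6] -/
theorem trForm_apply (A C : Matrix n n ℂ) : trForm A C = ((Aᴴ * C).trace).re := rfl

/-- Symmetry `⟨A, C⟩ = ⟨C, A⟩`. [cite: Hall2015, §3.6] -/
theorem trForm_comm (A C : Matrix n n ℂ) : trForm A C = trForm C A := by
  rw [trForm_apply, trForm_apply]
  conv_rhs => rw [← Matrix.conjTranspose_conjTranspose A, ← Matrix.conjTranspose_mul, Matrix.trace_conjTranspose]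
  rw [Complex.star_def, Complex.conj_re]

/-- `⟨A, A⟩ = Σ_{i,j} |A_{ij}|²`. [cite: Hall2015, §3.6] -/
theorem trForm_self_eq_sum (A : Matrix n n ℂ) : trForm A A = ∑ i, ∑ j, ‖A j i‖ ^ 2 := by
  rw [trForm_apply, Matrix.trace]
  simp only [Matrix.diag_apply, Matrix.mul_apply, Matrix.conjTranspose_apply, Complex.re_sum]
  refine Finset.sum_congr rfl fun i _ => Finset.sum_congr rfl fun j _ => ?_
  rw [Complex.star_def, Complex.conj_mul', ← Complex.ofReal_pow, Complex.ofReal_re]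

/-- `⟨A, A⟩ ≥ 0`. [cite: Hall2015, §3.6] -/
theorem trForm_self_nonneg (A : Matrix n n ℂ) : 0 ≤ trForm A A := by
  rw [trForm_self_eq_sum]; positivity

/-- `⟨A, A⟩ = 0 ↔ A = 0` (positive definiteness). [cite: Hall2015, §3.6] -/
theorem trForm_self_eq_zero_iff (A : Matrix n n ℂ) : trForm A A = 0 ↔ A = 0 := by
  refine ⟨fun h => ?_, fun h => by rw [h]; simp⟩
  rw [trForm_self_eq_sum] at h
  ext j i
  have hi := (Finset.sum_eq_zero_iff_of_nonneg fun i _ => by positivity).1 h i (Finset.mem_univ _)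
  have hj := (Finset.sum_eq_zero_iff_of_nonneg fun j _ => by positivity).1 hi j (Finset.mem_univ _)
  simpa using hj

/-- **`ad X` is skew for the trace form when `X* = −X`**: `⟨[X, A], C⟩ = −⟨A, [X, C]⟩`. [cite: Hall2015, Prop. 4.8] -/
theorem trForm_bracket_left {X : Matrix n n ℂ} (hX : star X = -X) (A C : Matrix n n ℂ) :
    trForm (X * A - A * X) C = -trForm A (X * C - C * X) := by
  have hXh : Xᴴ = -X := by rw [← Matrix.star_eq_conjTranspose]; exact hX
  rw [trForm_apply, trForm_apply, ← Complex.neg_re]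
  congr 1
  rw [Matrix.conjTranspose_sub, Matrix.conjTranspose_mul, Matrix.conjTranspose_mul, hXh, Matrix.mul_neg,
    Matrix.neg_mul, sub_neg_eq_add, add_mul, Matrix.neg_mul, Matrix.trace_add, Matrix.trace_neg, mul_sub,
    Matrix.trace_sub, neg_sub, Matrix.mul_assoc X, Matrix.trace_mul_comm X, ← Matrix.mul_assoc, Matrix.mul_assoc Aᴴ]
  ring

end TrForm

/-! ## §2  `tr ad X = 0` on any `ad`-stable real subspace of skew-adjoint matrices (compact ⇒ unimodular, infinitesimally) -/

section Trace

variable {𝔤 : Submodule ℝ (Matrix n n ℂ)} (hlie : ∀ x ∈ 𝔤, ∀ y ∈ 𝔤, x * y - y * x ∈ 𝔤)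
  (hskew : ∀ X ∈ 𝔤, star X = -X)

include hskew in
/-- **`tr(ad_𝐠 X) = 0`** for every `X` in an `ad`-stable real subspace `𝐠 ⊆ 𝔲(N)` — the Lie algebra of a compact
linear group is unimodular.  Proof: `ad X` is skew for the positive-definite trace form restricted to `𝐠`; in a basis
`b` with Gram matrix `P` (invertible) this reads `P·T = −Tᵀ·P` for `T = [ad X]_b`, so `tr T = −tr(P⁻¹TᵀP) = −tr T`.
[cite: Helgason2000, Ch. I §1 Thm. 1.14 p. 96] [cite: Balaban1985UV3, p. 260] -/
theorem trace_adg_eq_zero (x : 𝔤) : LinearMap.trace ℝ 𝔤 (adg hlie x : 𝔤 →ₗ[ℝ] 𝔤) = 0 := by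
  classical
  let b := Module.finBasis ℝ 𝔤
  set T := LinearMap.toMatrix b b (adg hlie x : 𝔤 →ₗ[ℝ] 𝔤) with hT
  let P : Matrix (Fin (Module.finrank ℝ 𝔤)) (Fin (Module.finrank ℝ 𝔤)) ℝ :=
    Matrix.of fun i j => trForm (b i : Matrix n n ℂ) (b j : Matrix n n ℂ)
  have hP : ∀ i j, P i j = trForm (b i : Matrix n n ℂ) (b j : Matrix n n ℂ) := fun i j => rfl
  -- columns of `T` are the coordinates of `ad x (b j)`
  have hcol : ∀ j, ∑ i, T i j • (b i : Matrix n n ℂ) = ((adg hlie x (b j) : 𝔤) : Matrix n n ℂ) := by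
    intro j
    have h := b.sum_repr (adg hlie x (b j))
    have h' := congrArg (fun v : 𝔤 => (v : Matrix n n ℂ)) h
    simp only [Submodule.coe_sum, Submodule.coe_smul] at h'
    rw [← h']
    simp only [hT, LinearMap.toMatrix_apply, ContinuousLinearMap.coe_coe]
  -- (1) skewness in coordinates
  have hPT : P * T = -(Tᵀ * P) := by
    ext k j
    simp only [Matrix.mul_apply, Matrix.neg_apply, Matrix.transpose_apply, hP]
    have lhs : ∑ i, trForm (b k : Matrix n n ℂ) (b i : Matrix n n ℂ) * T i j =
        trForm (b k : Matrix n n ℂ) ((adg hlie x (b j) : 𝔤) : Matrix n n ℂ) := by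
      rw [← hcol j, map_sum]
      simp only [map_smul, smul_eq_mul, mul_comm]
    have rhs : ∑ i, T i k * trForm (b i : Matrix n n ℂ) (b j : Matrix n n ℂ) =
        trForm ((adg hlie x (b k) : 𝔤) : Matrix n n ℂ) (b j : Matrix n n ℂ) := by
      rw [← hcol k, map_sum]
      simp only [map_smul, LinearMap.sum_apply, LinearMap.smul_apply, smul_eq_mul]
    rw [lhs, rhs, adg_apply_coe, adg_apply_coe, trForm_bracket_left (hskew x x.2), neg_neg]
  -- (2) the Gram matrix is invertible
  have hPinj : Function.Injective P.mulVec := by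
    intro v w hvw
    rw [← sub_eq_zero] at hvw ⊢
    rw [← Matrix.mulVec_sub] at hvw
    set d := v - w with hd
    have hq : trForm (∑ i, d i • (b i : Matrix n n ℂ)) (∑ i, d i • (b i : Matrix n n ℂ)) = d ⬝ᵥ (P *ᵥ d) := by
      simp only [map_sum, map_smul, LinearMap.sum_apply, LinearMap.smul_apply, smul_eq_mul, dotProduct,
        Matrix.mulVec, hP, Finset.mul_sum]
      refine Finset.sum_congr rfl fun i _ => Finset.sum_congr rfl fun j _ => ?_
      rw [trForm_comm (b j : Matrix n n ℂ)]
      ring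
    rw [hvw, dotProduct_zero, trForm_self_eq_zero_iff] at hq
    have hq' : ∑ i, d i • b i = 0 := by
      apply Subtype.ext
      simp only [Submodule.coe_sum, Submodule.coe_smul, Submodule.coe_zero]
      exact hq
    exact funext (Fintype.linearIndependent_iff.1 b.linearIndependent d hq')
  have hPdet : IsUnit P.det :=
    (Matrix.isUnit_iff_isUnit_det _).1 (Matrix.mulVec_injective_iff_isUnit.1 hPinj)
  -- (3) the trace
  have hTe : T = -(P⁻¹ * Tᵀ * P) := by
    calc T = P⁻¹ * (P * T) := by rw [← Matrix.mul_assoc, Matrix.nonsing_inv_mul _ hPdet, Matrix.one_mul]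
      _ = -(P⁻¹ * Tᵀ * P) := by rw [hPT, Matrix.mul_neg, Matrix.mul_assoc]
  have htr : T.trace = -T.trace := by
    conv_lhs => rw [hTe]
    rw [Matrix.trace_neg, Matrix.mul_assoc, Matrix.trace_mul_comm, Matrix.mul_assoc, Matrix.mul_nonsing_inv _ hPdet,
      Matrix.mul_one, Matrix.trace_transpose]
  rw [LinearMap.trace_eq_matrix_trace ℝ b, ← hT]
  linarith

include hskew in
/-- Hence **`det jac(−X) = det jac(X)`** («σ is an even function of A») on any `ad`-stable real subspace
`𝐠 ⊆ 𝔲(N)` — r10's `det_jac_real_neg_of_trace_eq_zero` with its trace hypothesis DISCHARGED.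
[cite: Balaban1985UV3, p. 260] [cite: Helgason2000, Ch. I §1 Thm. 1.14 p. 96] -/
theorem det_jac_neg (x : 𝔤) :
    LinearMap.det (jac hlie (-x) : 𝔤 →ₗ[ℝ] 𝔤) = LinearMap.det (jac hlie x : 𝔤 →ₗ[ℝ] 𝔤) :=
  det_jac_real_neg_of_trace_eq_zero hlie (Module.finBasis ℝ 𝔤) x (trace_adg_eq_zero hlie hskew x)

end Trace

/-! ## §3  For every closed `G ≤ U(N)`: `σ/σ₀ = det jac` is EVEN and `Ad(G)`-INVARIANT on `𝐠` -/

section ClosedSubgroup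

variable (Gs : Subgroup (Matrix.unitaryGroup n ℂ)) (hG : IsClosed (Gs : Set (Matrix.unitaryGroup n ℂ)))

/-- `tr(ad_𝐠 X) = 0` on the Lie algebra of every closed `G ≤ U(N)`. [cite: Balaban1985UV3, p. 260]
[cite: Helgason2000, Ch. I §1 Thm. 1.14 p. 96] -/
theorem trace_adg_chart_eq_zero (x : (chart Gs hG).lie) :
    LinearMap.trace ℝ (chart Gs hG).lie (adg (hlie Gs hG) x : (chart Gs hG).lie →ₗ[ℝ] (chart Gs hG).lie) = 0 :=
  trace_adg_eq_zero (hlie Gs hG) (fun _ hX => star_eq_neg_of_mem_unitarySubgroupLogChart_lie Gs hG hX) x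

/-- **«σ(A) is an … even function of A»** for EVERY closed `G ≤ U(N)`: `det jac(−X) = det jac(X)` on `𝐠`, i.e. the
Haar density `σ/σ₀ = jdet` of `HaarExpChartClosedSubgroup` is even. [cite: Balaban1985UV3, p. 260] -/
theorem jdet_neg (x : (chart Gs hG).lie) : jdet (hlie Gs hG) (-x) = jdet (hlie Gs hG) x := by
  rw [jdet_eq_det, jdet_eq_det]
  exact det_jac_neg (hlie Gs hG) (fun _ hX => star_eq_neg_of_mem_unitarySubgroupLogChart_lie Gs hG hX) x

/-- `Ad u` preserves `𝐠` for `u ∈ G` (gen 8's `LogChart.conj_mem_lie`). [cite: Hall2015, Thm. 3.20] -/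
theorem conj_mem_lie (u : Gs) {X : Matrix n n ℂ} (hX : X ∈ (chart Gs hG).lie) :
    ((u : Matrix.unitaryGroup n ℂ) : Matrix n n ℂ) * X * star ((u : Matrix.unitaryGroup n ℂ) : Matrix n n ℂ) ∈
      (chart Gs hG).lie :=
  LogChart.conj_mem_lie (chart Gs hG) ⟨(u : Matrix.unitaryGroup n ℂ), u.2, rfl⟩
    (star_mem_unitarySubgroupLogChart_carrier Gs hG ⟨(u : Matrix.unitaryGroup n ℂ), u.2, rfl⟩)
    (Matrix.mem_unitaryGroup_iff'.1 (u : Matrix.unitaryGroup n ℂ).2) hX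

/-- `Ad u⁻¹` preserves `𝐠` for `u ∈ G`. [cite: Hall2015, Thm. 3.20] -/
theorem conj_mem_lie' (u : Gs) {X : Matrix n n ℂ} (hX : X ∈ (chart Gs hG).lie) :
    star ((u : Matrix.unitaryGroup n ℂ) : Matrix n n ℂ) * X * ((u : Matrix.unitaryGroup n ℂ) : Matrix n n ℂ) ∈
      (chart Gs hG).lie := by
  have h := conj_mem_lie Gs hG u⁻¹ hX
  simp only [Subgroup.coe_inv, Matrix.UnitaryGroup.inv_apply, star_star] at h
  exact h

/-- The unitary `u ∈ G` as a unit of `M_N(ℂ)` (inverse `u*`). [cite: Hall2015, Thm. 3.20] -/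
def toUnit (u : Gs) : (Matrix n n ℂ)ˣ where
  val := ((u : Matrix.unitaryGroup n ℂ) : Matrix n n ℂ)
  inv := star ((u : Matrix.unitaryGroup n ℂ) : Matrix n n ℂ)
  val_inv := Matrix.mem_unitaryGroup_iff.1 (u : Matrix.unitaryGroup n ℂ).2
  inv_val := Matrix.mem_unitaryGroup_iff'.1 (u : Matrix.unitaryGroup n ℂ).2

/-- [cite: Hall2015, Thm. 3.20] -/
@[simp] theorem coe_toUnit (u : Gs) : ((toUnit Gs u : (Matrix n n ℂ)ˣ) : Matrix n n ℂ) =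
    ((u : Matrix.unitaryGroup n ℂ) : Matrix n n ℂ) := rfl

/-- [cite: Hall2015, Thm. 3.20] -/
@[simp] theorem coe_toUnit_inv (u : Gs) : (((toUnit Gs u)⁻¹ : (Matrix n n ℂ)ˣ) : Matrix n n ℂ) =
    star ((u : Matrix.unitaryGroup n ℂ) : Matrix n n ℂ) := rfl

/-- `Ad u` stability hypotheses of r10's `Adg`, discharged for `u ∈ G`. [cite: Hall2015, Thm. 3.20] -/
theorem hAd (u : Gs) : ∀ y ∈ (chart Gs hG).lie,
    ((toUnit Gs u : (Matrix n n ℂ)ˣ) : Matrix n n ℂ) * y * (((toUnit Gs u)⁻¹ : (Matrix n n ℂ)ˣ) : Matrix n n ℂ) ∈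
      (chart Gs hG).lie :=
  fun _ hy => conj_mem_lie Gs hG u hy

/-- [cite: Hall2015, Thm. 3.20] -/
theorem hAd' (u : Gs) : ∀ y ∈ (chart Gs hG).lie,
    (((toUnit Gs u)⁻¹ : (Matrix n n ℂ)ˣ) : Matrix n n ℂ) * y * ((toUnit Gs u : (Matrix n n ℂ)ˣ) : Matrix n n ℂ) ∈
      (chart Gs hG).lie :=
  fun _ hy => conj_mem_lie' Gs hG u hy

/-- **«σ(A) is … invariant with respect to the adjoint representation of the group G»** for EVERY closed `G ≤ U(N)`:
`det jac(uXu*) = det jac(X)` for `u ∈ G`, `X ∈ 𝐠` (r10's `det_jac_Adg` with its `Ad`-stability hypotheses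
DISCHARGED by gen 8's `LogChart.conj_mem_lie`). [cite: Balaban1985UV3, p. 260] -/
theorem jdet_Ad (u : Gs) (x : (chart Gs hG).lie) :
    jdet (hlie Gs hG) (Adg (hAd Gs hG u) (hAd' Gs hG u) x) = jdet (hlie Gs hG) x := by
  rw [jdet_eq_det, jdet_eq_det]
  exact det_jac_Adg (hlie Gs hG) (hAd Gs hG u) (hAd' Gs hG u) x

/-- The `Ad`-moved element, in matrices: `Ad u X = u X u*`. [cite: Balaban1985UV3, p. 260] -/
theorem coe_Adg (u : Gs) (x : (chart Gs hG).lie) :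
    ((Adg (hAd Gs hG u) (hAd' Gs hG u) x : (chart Gs hG).lie) : Matrix n n ℂ) =
      ((u : Matrix.unitaryGroup n ℂ) : Matrix n n ℂ) * x * star ((u : Matrix.unitaryGroup n ℂ) : Matrix n n ℂ) := rfl

end ClosedSubgroup

end Literature.MathematicalPhysics.QuantumFieldTheory.Balaban1983to89.HaarDensityEvenClosedSubgroup

end
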